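import Mathlib.Probability.Distributions.Uniform
import Literature.Computability.Cryptography.Shor
import Literature.Computability.MetaComplexity.DistProblems
import HarnessLib

/-!
# The Blum–Micali "half" predicate of the discrete logarithm

Trunk T-CRYPTO (Literature/Computability/Cryptography); definition request `defn-DLOGHalf`
(route QuantumAdvantage/AvgCase, crux #2). Two notions next to `Literature.Computability.Cryptography.IsDLogInstance`
(`Shor.lean`):

* `Literature.PQC.DLOGHalf : Language Bool` — the encodings `encodeDLogInstance p g y` of discrete-log
  instances `(p, g, y)` (prime `p`, primitive root `g`, unit `y`) whose discrete logarithm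
  `a = index_{p,g}(y) ∈ [0, p-1)` lies in the lower half, `2a < p - 1`. This is the decision
  (hard-core-bit) version of DLOG of Blum–Micali: `B_{p,g}(y) = 1` iff the index of `y` lies in
  the first half of the exponent range; Blum–Micali (§3) prove that computing this bit (even with
  a small advantage on average over `y`) is as hard as computing discrete logarithms.
* `Literature.PQC.dlogHalfEnsemble pseq : Literature.CplxMeta.Ensemble` — for a sequence of (intended) prime /
  primitive-root pairs `pseq n = (p_n, g_n)`, the `n`-th distribution is the law of
  `encodeDLogInstance p_n g_n y` with `y` uniform on `[1, p_n)` (Mathlib `PMF.uniformOfFinset` on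
  `Finset.Ico 1 p_n`, pushed forward by `PMF.map`).

## Sources

* M. Blum, S. Micali, *How to generate cryptographically strong sequences of pseudo-random bits*,
  SIAM J. Comput. 13 (1984) 850–864, §3 (the discrete-logarithm half predicate `B_{p,g}` and its
  hardness).
* P. W. Shor, *Polynomial-time algorithms for prime factorization and discrete logarithms on a
  quantum computer*, SIAM J. Comput. 26 (1997), §6 (DLOG instances `(p, g, x)`).
* A. Bogdanov, L. Trevisan, *Average-case complexity* (2006), §2.1 (ensembles).

## Design choices

* Exponent normalisation follows `dlogSolutions` (`a ∈ [0, p-1)`), so "lower half" is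
  `2 * a < p - 1` (as requested by the route); Blum–Micali index exponents by `[1, p-1]`, which
  shifts the predicate on one residue only — immaterial for hardness statements, recorded here.
* `dlogHalfEnsemble` needs `Finset.Ico 1 p` nonempty, i.e. `1 < p`; for `p ≤ 1` (never an
  instance) the `n`-th distribution is the JUNK point mass at `encodeDLogInstance p g 0`
  (documented junk value; `0` is not a unit so the string is not in `DLOGHalf`).
* Mathlib: `PMF.uniformOfFinset`, `PMF.map`, `Language`; no discrete-log material (see
  `Shor.lean`).
-/

noncomputable section

namespace Literature.Computability.Cryptography

open _root_.Computability MetaComplexity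

/-- `DLOGHalf`: the language of encoded discrete-log instances `(p, g, y)` (`IsDLogInstance`)
whose discrete logarithm lies in the lower half of the exponent range: some (equivalently, the
unique) `a ∈ dlogSolutions p g y` has `2a < p - 1`. The Blum–Micali hard-core predicate of
modular exponentiation, as a decision problem. [Blum–Micali 1984, §3 (the predicate `B_{p,g}`);
Shor 1997, §6 (instances)] [cite: BlumMicali1984, §3] -/
def DLOGHalf : Language Bool :=
  {x | ∃ p g y : ℕ, x = encodeDLogInstance p g y ∧ IsDLogInstance p g y ∧
    ∃ a ∈ dlogSolutions p g y, 2 * a < p - 1}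

/-- `dlogHalfEnsemble pseq`: the ensemble whose `n`-th distribution is the law of
`encodeDLogInstance p_n g_n y` for `(p_n, g_n) = pseq n` and `y` uniform on `{1, …, p_n - 1}`
(the uniform unit modulo a prime `p_n`); junk point mass at `y = 0` if `p_n ≤ 1`.
[Blum–Micali 1984, §3 (uniform `y ∈ ℤ_p^*`); Bogdanov–Trevisan 2006, §2.1 (ensembles)] [cite: BlumMicali1984, §3] -/
def dlogHalfEnsemble (pseq : ℕ → ℕ × ℕ) : Ensemble := fun n =>
  if h : 1 < (pseq n).1 then
    (PMF.uniformOfFinset (Finset.Ico 1 (pseq n).1) ⟨1, by simp [h]⟩).map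
      fun y => encodeDLogInstance (pseq n).1 (pseq n).2 y
  else PMF.pure (encodeDLogInstance (pseq n).1 (pseq n).2 0)

/-! ### API -/

/-- Membership of an encoded triple in `DLOGHalf`, unfolded (the encoding is injective).
[Blum–Micali 1984, §3] [folklore] -/
theorem encodeDLogInstance_mem_DLOGHalf_iff (p g y : ℕ) :
    encodeDLogInstance p g y ∈ DLOGHalf ↔
      IsDLogInstance p g y ∧ ∃ a ∈ dlogSolutions p g y, 2 * a < p - 1 := by
  constructor
  · rintro ⟨p', g', y', he, hi, ha⟩
    have := encodeDLogInstance_injective (a₁ := (p, g, y)) (a₂ := (p', g', y')) he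
    simp only [Prod.mk.injEq] at this
    obtain ⟨rfl, rfl, rfl⟩ := this
    exact ⟨hi, ha⟩
  · rintro ⟨hi, ha⟩
    exact ⟨p, g, y, rfl, hi, ha⟩

/-- Strings in `DLOGHalf` encode instances. [Blum–Micali 1984, §3] [folklore] -/
theorem exists_isDLogInstance_of_mem_DLOGHalf {x : List Bool} (h : x ∈ DLOGHalf) :
    ∃ p g y : ℕ, x = encodeDLogInstance p g y ∧ IsDLogInstance p g y := by
  obtain ⟨p, g, y, he, hi, -⟩ := h
  exact ⟨p, g, y, he, hi⟩

/-- For `1 < p_n` the support of the `n`-th distribution is exactly the set of encodings of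
`(p_n, g_n, y)` with `1 ≤ y < p_n`. [Blum–Micali 1984, §3; Mathlib `PMF.support_map`,
`PMF.support_uniformOfFinset`] [folklore] -/
theorem support_dlogHalfEnsemble (pseq : ℕ → ℕ × ℕ) (n : ℕ) (h : 1 < (pseq n).1) :
    (dlogHalfEnsemble pseq n).support =
      (fun y => encodeDLogInstance (pseq n).1 (pseq n).2 y) '' Set.Ico 1 (pseq n).1 := by
  simp only [dlogHalfEnsemble, dif_pos h, PMF.support_map, PMF.support_uniformOfFinset,
    Finset.coe_Ico]

/-- For `1 < p_n`, each encoding `encodeDLogInstance p_n g_n y` with `1 ≤ y < p_n` has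
probability exactly `1/(p_n - 1)`. [Blum–Micali 1984, §3 (uniform unit)] [folklore] -/
theorem dlogHalfEnsemble_apply_encode (pseq : ℕ → ℕ × ℕ) (n : ℕ) (h : 1 < (pseq n).1) {y : ℕ}
    (hy : y ∈ Finset.Ico 1 (pseq n).1) :
    dlogHalfEnsemble pseq n (encodeDLogInstance (pseq n).1 (pseq n).2 y) =
      (((pseq n).1 - 1 : ℕ) : ENNReal)⁻¹ := by
  simp only [dlogHalfEnsemble, dif_pos h]
  have hinj : ∀ a : ℕ, encodeDLogInstance (pseq n).1 (pseq n).2 y =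
      encodeDLogInstance (pseq n).1 (pseq n).2 a ↔ a = y := fun a =>
    ⟨fun he => by
      have := encodeDLogInstance_injective (a₁ := ((pseq n).1, (pseq n).2, y))
        (a₂ := ((pseq n).1, (pseq n).2, a)) he
      simp only [Prod.mk.injEq, true_and] at this
      exact this.symm, fun h => by rw [h]⟩
  rw [PMF.map_apply]
  simp only [hinj]
  rw [tsum_ite_eq, PMF.uniformOfFinset_apply_of_mem _ hy, Nat.card_Ico]

end Literature.Computability.Cryptography
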